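import Summits.QuantumFields.BalabanUV.T4Continuum.Support.AveragingDeficitBlockDensityGrad
import HarnessLib

/-!
# AveragingDeficitBlockDensityGradSum (T⁴ programme, node NE3, row NE3-R2, gen 6) — THE GRADIENT BOUND OF THE BLOCK DENSITY ON THE
# TORUS: `covGradSq U (S₀φ) ([0,LM)^d) ≤ 2·L^{d−1}/L²·covGradSq (cavg L U) φ ([0,M)^d) + kGradS0(d,L)·a²·dirSq φ ([0,M)^d)`
# (file 3b of (γ2), the gradient-bounded one-step lift — record `t4/T4-EST-NE3-R2.md` v0.6 §4)

HONEST FRAMING (cell `pub-balaban`, T4-DAG PAGE 1; unit `b2b-balaban-t4-ne3r2-p1` = owner of BINDER-OWNERS row NE3-R2, gen 6).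
The cell's T4 target is the finite-torus continuum limit of the unit-scale averaged loop expectations — NOT infinite volume, NO
mass gap, NOT Clay, NOT summit progress.  WHY.  (γ2) needs the covariant gradient of the lift controlled by the coarse covariant
gradient of the datum; file 3 (`AveragingDeficitBlockDensityGrad`) bounds the covariant forward differences of the block density
`S₀ = blockDensity` pointwise (inside a block: `O(a)L⁻¹‖φ‖`; across a face: `L⁻¹·Ad_T(covFd (cavg L U) φ) + O(a)L⁻¹‖φ‖`).  THIS FILE
sums the squares over one period, block by block: the `L^{d−1}` exit-face sites of each block and direction carry the coarse covariant
difference with weight `L⁻²`, all `L^d` sites carry `O(a²)‖φ‖²` (face sites counted by leaf-01's `SpreadLift.card_filter_coord_eq`,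
the shifted coarse sums folded back by `sum_periodBox_shift`).  All [folklore], 0 sorry: §1 the constants `kSame`, `kCross`, `kOwn`,
`kGradS0` (polynomials in `d`, `L`); §2 `sum_block_covFd_sq_le` (one block, one pair of directions) and
**`covGradSq_blockDensity_le`**: for `U` unitary of period `L·M` in `SmallField U a` with `512(d+1)(d+4)L²a ≤ 1` and coarse data `φ`
of period `M ≥ 1`, `covGradSq U (blockDensity L U φ) (periodBox (L·M)) ≤ 2·L^{d−1}/L²·covGradSq (cavg L U) φ (periodBox M)
+ kGradS0 d L·a²·dirSq φ (periodBox M)`.  NE3 ITSELF IS NOT PROVED; nothing of Bałaban's is asserted (context: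
[Balaban1985Averaging] (42) p. 23, p. 24–25).  ABSOLUTE RULE kept: no printed sentence is a hypothesis.  PLACEMENT:
`Summits/QuantumFields/BalabanUV/`; imports this row's `AveragingDeficitBlockDensityGrad`; moves nothing.
-/

set_option autoImplicit false

open scoped BigOperators Matrix Matrix.Norms.L2Operator
open NormedSpace Finset

namespace Summit.QuantumFields.BalabanUV.T4Continuum.AveragingDeficitBlockDensityGradSum

open Literature.MathematicalPhysics.QuantumFieldTheory.Balaban1983to89
open B7Prop1Explicit B7Prop2Explicit MatrixLog UnitaryModel
open T4AveragingDeficitWall hiding Site Plane Plaq Bond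
open T4AveragingDeficitWallBoundary (IsPeriodicCfg periodBox blockSites_periodBox sum_blocks_eq sum_periodBox_shift)
open AveragingDeficitPeriodicCounting (IsPeriodicDir)
open AveragingDeficitChartCalculus (cavg)
open AveragingDeficitCovGrad (covFd covGradSq)
open SpreadLift (loopRad card_filter_coord_eq)
open SpreadLiftWords (cdiv_smul_add_boxVec cmod_smul_add_boxVec)
open SkeletonLattice (cdiv cmod)
open AveragingDeficitBlockDensity AveragingDeficitBlockDensityGrad

noncomputable section

variable {d : ℕ} {n : Type*} [Fintype n] [DecidableEq n]

/-! ## §1 The constants -/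

/-- The in-block constant: `cA = kSame·a`, `kSame = 2(2dL+6)²/L`. [folklore] -/
def kSame (d L : ℕ) : ℝ := 2 * (2 * d * L + 6 : ℝ) ^ 2 / L

/-- The face constant of the neighbour's value: `c₁ = kCross·a`, `kCross = 2((2d+1)L+6)² + 256(d+1)(d+4)L²`. [folklore] -/
def kCross (d L : ℕ) : ℝ := 2 * ((2 * d + 1) * L + 6 : ℝ) ^ 2 + 16 * (16 * ((d : ℝ) + 1) * ((d : ℝ) + 4) * (L : ℝ) ^ 2)

/-- The face constant of the own value: `c₂ = kOwn·a`, `kOwn = 128(d+1)(d+4)L²`. [folklore] -/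
def kOwn (d L : ℕ) : ℝ := 8 * (16 * ((d : ℝ) + 1) * ((d : ℝ) + 4) * (L : ℝ) ^ 2)

/-- THE CONSTANT OF THE `dirSq` TERM of the gradient bound of the block density. [folklore] -/
def kGradS0 (d L : ℕ) : ℝ :=
  d * (4 * (L : ℝ) ^ (d - 1) / (L : ℝ) ^ 2 * (kCross d L ^ 2 + kOwn d L ^ 2) + (L : ℝ) ^ d * kSame d L ^ 2)

omit [Fintype n] [DecidableEq n] in
/-- `loopRad = 16(d+1)(d+4)L²·a`. [folklore] -/
theorem loopRad_eq (L : ℕ) (a : ℝ) : loopRad d L a = 16 * ((d : ℝ) + 1) * ((d : ℝ) + 4) * (L : ℝ) ^ 2 * a := by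
  unfold SpreadLift.loopRad; ring

omit [Fintype n] [DecidableEq n] in
/-- Splitting a sum over block offsets by the value of one coordinate: `Σ_r f(r) ≤ L^{d−1}·B + L^d·A` when `f ≤ B` on
`{r_μ = c}` and `f ≤ A` (`A ≥ 0`) elsewhere. [folklore] -/
theorem sum_offsets_split_le (L : ℕ) (μ : Fin d) (c : Fin L) (f : (Fin d → Fin L) → ℝ) {A B : ℝ} (hA : 0 ≤ A)
    (hf : ∀ r, f r ≤ if r μ = c then B else A) :
    ∑ r : Fin d → Fin L, f r ≤ (L : ℝ) ^ (d - 1) * B + (L : ℝ) ^ d * A := by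
  refine (Finset.sum_le_sum fun r _ => hf r).trans ?_
  rw [Finset.sum_ite, Finset.sum_const, Finset.sum_const, card_filter_coord_eq, nsmul_eq_mul, nsmul_eq_mul]
  push_cast
  refine add_le_add le_rfl (mul_le_mul_of_nonneg_right ?_ hA)
  have h := Finset.card_filter_le (Finset.univ : Finset (Fin d → Fin L)) (fun r => ¬ r μ = c)
  rw [Finset.card_univ, Fintype.card_fun, Fintype.card_fin, Fintype.card_fin] at h
  exact_mod_cast h

/-! ## §2 The period sum -/

section Sum

variable [Nonempty n] {L : ℕ} (hL : 1 ≤ L) {U : Site d → Fin d → (Matrix n n ℂ)ˣ} (hU : IsUnitaryCfg U) {a : ℝ} (ha : 0 ≤ a)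
  (h512 : 512 * (d + 1) * (d + 4) * (L : ℝ) ^ 2 * a ≤ 1) (hUa : SmallField U a)

include hL hU ha h512 hUa

/-- ONE BLOCK, ONE PAIR OF DIRECTIONS: `Σ_{x∈B(y)} ‖covFd U (S₀φ) x μ ν‖² ≤ L^{d−1}·crossB + L^d·sameB`. [folklore] -/
theorem sum_block_covFd_sq_le (φ : Site d → Fin d → Matrix n n ℂ) (y : Site d) (μ ν : Fin d) :
    ∑ r : Fin d → Fin L, ‖covFd U (blockDensity L U φ) ((L : ℤ) • y + boxVec L r) μ ν‖ ^ 2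
      ≤ (L : ℝ) ^ (d - 1) * (2 * ((L : ℝ)⁻¹) ^ 2 * ‖covFd (cavg L U) φ y μ ν‖ ^ 2
            + 4 * ((L : ℝ)⁻¹) ^ 2 * ((kCross d L * a) ^ 2 * ‖φ (y + e μ) ν‖ ^ 2 + (kOwn d L * a) ^ 2 * ‖φ y ν‖ ^ 2))
        + (L : ℝ) ^ d * ((kSame d L * a) ^ 2 * ‖φ y ν‖ ^ 2) := by
  refine sum_offsets_split_le L μ ⟨L - 1, by omega⟩ _ (by positivity) fun r => ?_
  set x : Site d := (L : ℤ) • y + boxVec L r with hx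
  have hcd : cdiv L x = y := cdiv_smul_add_boxVec L y r
  have hcm : cmod L x μ = ((r μ : ℕ) : ℤ) := by rw [hx, cmod_smul_add_boxVec]; rfl
  split_ifs with hr
  · -- exit face: cross bound
    have hcross : cdiv L (x + e μ) = cdiv L x + e μ := by
      refine cdiv_add_e_of_eq hL x μ ?_
      rw [hcm, hr]; push_cast [Nat.cast_sub hL]; omega
    have h := normSq_covFd_blockDensity_cross_le hL hU ha h512 hUa φ x μ ν hcross
    rw [hcd] at h
    refine h.trans (le_of_eq ?_)
    rw [loopRad_eq, kCross, kOwn]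
    ring
  · -- inside: same bound
    have hsame : cdiv L (x + e μ) = cdiv L x := by
      refine cdiv_add_e_of_lt hL x μ ?_
      rw [hcm]
      have h1 : (r μ : ℕ) < L := (r μ).isLt
      have h2 : (r μ : ℕ) ≠ L - 1 := fun h => hr (Fin.ext h)
      omega
    have h := norm_covFd_blockDensity_same_le hL hU ha hUa φ x μ ν hsame
    rw [hcd] at h
    have h0 : 0 ≤ ‖covFd U (blockDensity L U φ) x μ ν‖ := norm_nonneg _
    calc ‖covFd U (blockDensity L U φ) x μ ν‖ ^ 2
        ≤ ((L : ℝ)⁻¹ * (2 * ((2 * d * L + 6 : ℝ) ^ 2 * a)) * ‖φ y ν‖) ^ 2 := pow_le_pow_left₀ h0 h 2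
      _ = (kSame d L * a) ^ 2 * ‖φ y ν‖ ^ 2 := by rw [kSame]; ring

/-- **THE GRADIENT BOUND OF THE BLOCK DENSITY ON THE TORUS**: for `U` unitary of period `L·M` in `SmallField U a` with
`512(d+1)(d+4)L²a ≤ 1` and coarse data `φ` of period `M` (`M ≥ 1`),
`covGradSq U (S₀φ) ([0,LM)^d) ≤ 2·L^{d−1}/L²·covGradSq (cavg L U) φ ([0,M)^d) + kGradS0(d,L)·a²·dirSq φ ([0,M)^d)`. [folklore] -/
theorem covGradSq_blockDensity_le {M : ℕ} (hM : 1 ≤ M) {φ : Site d → Fin d → Matrix n n ℂ} (hφ : IsPeriodicDir φ (M : ℤ)) :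
    covGradSq U (blockDensity L U φ) (periodBox (L * M))
      ≤ 2 * (L : ℝ) ^ (d - 1) / (L : ℝ) ^ 2 * covGradSq (cavg L U) φ (periodBox M)
        + kGradS0 d L * a ^ 2 * dirSq φ (periodBox M) := by
  -- block decomposition
  have hblocks := sum_periodBox_blocks hL M
    (fun _ x => ∑ μ : Fin d, ∑ ν : Fin d, ‖covFd U (blockDensity L U φ) x μ ν‖ ^ 2)
  unfold covGradSq
  rw [hblocks]
  -- the shifted sum `Σ_y Σ_μ Σ_ν ‖φ(y+e_μ,ν)‖² = d·dirSq φ`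
  have hshift : ∑ y ∈ periodBox M, ∑ μ : Fin d, ∑ ν : Fin d, ‖φ (y + e μ) ν‖ ^ 2 = (d : ℝ) * dirSq φ (periodBox M) := by
    rw [Finset.sum_comm]
    have : ∀ μ : Fin d, ∑ y ∈ periodBox M, ∑ ν : Fin d, ‖φ (y + e μ) ν‖ ^ 2 = dirSq φ (periodBox M) := fun μ => by
      unfold dirSq
      exact sum_periodBox_shift M hM (g := fun y => ∑ ν : Fin d, ‖φ y ν‖ ^ 2) (fun y κ => by simp only [hφ y κ]) (e μ)
    simp only [this, Finset.sum_const, Finset.card_univ, Fintype.card_fin, nsmul_eq_mul]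
  have hown : ∑ y ∈ periodBox M, ∑ _μ : Fin d, ∑ ν : Fin d, ‖φ y ν‖ ^ 2 = (d : ℝ) * dirSq φ (periodBox M) := by
    unfold dirSq
    simp only [Finset.sum_const, Finset.card_univ, Fintype.card_fin, nsmul_eq_mul, Finset.mul_sum]
  have hcov : covGradSq (cavg L U) φ (periodBox M) = ∑ y ∈ periodBox M, ∑ μ : Fin d, ∑ ν : Fin d, ‖covFd (cavg L U) φ y μ ν‖ ^ 2 := rfl
  -- blockwise bound
  calc ∑ y ∈ periodBox M, ∑ r : Fin d → Fin L, ∑ μ : Fin d, ∑ ν : Fin d,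
          ‖covFd U (blockDensity L U φ) ((L : ℤ) • y + boxVec L r) μ ν‖ ^ 2
      = ∑ y ∈ periodBox M, ∑ μ : Fin d, ∑ ν : Fin d, ∑ r : Fin d → Fin L,
          ‖covFd U (blockDensity L U φ) ((L : ℤ) • y + boxVec L r) μ ν‖ ^ 2 := by
        refine Finset.sum_congr rfl fun y _ => ?_
        rw [Finset.sum_comm]
        exact Finset.sum_congr rfl fun μ _ => Finset.sum_comm
    _ ≤ ∑ y ∈ periodBox M, ∑ μ : Fin d, ∑ ν : Fin d,
          ((L : ℝ) ^ (d - 1) * (2 * ((L : ℝ)⁻¹) ^ 2 * ‖covFd (cavg L U) φ y μ ν‖ ^ 2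
              + 4 * ((L : ℝ)⁻¹) ^ 2 * ((kCross d L * a) ^ 2 * ‖φ (y + e μ) ν‖ ^ 2 + (kOwn d L * a) ^ 2 * ‖φ y ν‖ ^ 2))
            + (L : ℝ) ^ d * ((kSame d L * a) ^ 2 * ‖φ y ν‖ ^ 2)) :=
        Finset.sum_le_sum fun y _ => Finset.sum_le_sum fun μ _ => Finset.sum_le_sum fun ν _ =>
          sum_block_covFd_sq_le hL hU ha h512 hUa φ y μ ν
    _ = 2 * (L : ℝ) ^ (d - 1) / (L : ℝ) ^ 2 * covGradSq (cavg L U) φ (periodBox M)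
        + kGradS0 d L * a ^ 2 * dirSq φ (periodBox M) := by
        simp only [Finset.sum_add_distrib, ← Finset.mul_sum, hshift, hown, hcov, kGradS0]
        ring

end Sum

end

end Summit.QuantumFields.BalabanUV.T4Continuum.AveragingDeficitBlockDensityGradSum
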